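import Literature.Analysis.FluidPDE.LeiZhang2011RegularityHolds
import Literature.Analysis.FluidPDE.AxisymmetricL3Gauge
import Literature.Analysis.FluidPDE.LeiZhang2017AxisymmetricCriteria
import Summits.NavierStokesRegularity.NavierStokesRegularity.Theorems.CertifiedBlowupCertifiedBlowupAxisymBlowupBlowupSet
import HarnessLib

/-!
# Witnesses of the crux `CertifiedBlowupAxisymBlowup` admit no stream function bounded in `BMO`
# up to the singular time (Lei–Zhang 2011, Thm. 1.4, at the crux)

Theorems file landed `--supports stmt-NavierStokesRegularity-0727`, line `compact-amplification`
(continuation lead c3, wave 1; bet route `SwirlThreshold`). A witness of the crux is a maximal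
smooth solution `(u, p)` of finite lifespan `T` of the unforced Navier–Stokes system, Leray–Hopf on
`[0, T]` from its rapidly decaying axisymmetric datum `u 0`. Lei–Zhang 2011, Theorem 1.4
(arXiv:1011.5066, p. 4; proof §4, pp. 12–13) answers Koch–Tataru's question (regularity in
`L^∞(0, T; BMO⁻¹)`) in the axisymmetric class: an axisymmetric suitable Leray–Hopf solution whose
velocity admits a stream function bounded in `BMO`, `u(t) = ∇ × B(t)` with
`sup_{0<t<T} ‖B(t)‖_BMO ≤ C_*`, is smooth on `ℝ³ × (0, T]`. The tree PROVES this named fact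
(`LeiZhang2011_regularity_bmoStream_holds`). This file records its contrapositive at the crux,
kernel-checked and unconditional:

* `isBoundedNearTop_of_ae_eq_continuousOn_Ioc` — if `u`, continuous on `(0, T) × ℝ³`, agrees a.e.
  there with a field `w` continuous on `(0, T] × ℝ³`, then `u` is bounded on a backward parabolic
  neighbourhood of `(T, x₀)` for EVERY `x₀` (compactness of `[T/2, T] × B̄(x₀, 1)`, and an a.e.
  bound between continuous functions on an open set holds everywhere);
* `exists_smooth_representative_of_hasBMOStreamFunctionOn_one` — the hypotheses of the tree form
  of Theorem 1.4 hold for every unit-viscosity witness carrying a `BMO` stream function on `(0, T)`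
  (suitability on the open slab from `AxisymmetricL3Hyp.isSuitableWeakSolutionOn`, axisymmetric
  slices from `isAxisymmetric_slice_of_lerayHopf_classical`, bounded initial swirl from
  `HasRapidSpatialDecay.abs_swirl_le`), so `u` has a smooth representative on `(0, T] × ℝ³`;
* `not_hasBMOStreamFunction_of_isMaximalSmoothSolution_one` (registered stub) — **no
  unit-viscosity witness admits a stream function bounded in `BMO` on `(0, T)`**: otherwise every
  point would be a point of local boundedness at `T`, contradicting the nonempty blow-up set of a
  witness (`exists_not_isBoundedNearTop_of_isMaximalSmoothSolution`). This is the kernel form of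
  route `SwirlThreshold`'s honest residue "the poloidal field stays supercritical"
  (`u ∉ L^∞_t BMO⁻¹_x` up to `T`), strictly generalising the landed no-axis-bound
  `not_axisBound_of_isMaximalSmoothSolution` (`r|u| ≤ C`). Unit viscosity is no restriction by the
  landed normal form `certifiedBlowupAxisymBlowup_iff_forall_nu_T`.

No new definitions, no named-fact hypotheses, no `sorry`.

## References

* Z. Lei, Q. S. Zhang, *A Liouville theorem for the axially-symmetric Navier–Stokes equations*,
  J. Funct. Anal. 261 (2011) 2323–2345 = arXiv:1011.5066, Thm. 1.4 (p. 4; proof §4 pp. 12–13).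
  [LeiZhang2011]
* H. Koch, D. Tataru, *Well-posedness for the Navier–Stokes equations*, Adv. Math. 157 (2001).
  [KochTataru2001]
* G. Koch, N. Nadirashvili, G. Seregin, V. Šverák, *Liouville theorems for the Navier–Stokes
  equations and applications*, Acta Math. 203 (2009), Thm. 5.3. [KNSS2009]
-/

-- the summit and its single problem share the name (D-0017 nested layout)
set_option linter.dupNamespace false

noncomputable section

open MeasureTheory Set Function Filter Topology Metric
open scoped ENNReal NNReal

namespace Summit.NavierStokesRegularity.NavierStokesRegularity.Theorems.CertifiedBlowupAxisymBlowup.CompactAmplification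

open Literature.Analysis.FluidPDE

section Witness

variable {T : ℝ} {u : ℝ → EuclideanSpace ℝ (Fin 3) → EuclideanSpace ℝ (Fin 3)}
  {p : ℝ → EuclideanSpace ℝ (Fin 3) → ℝ}

/-- **Local boundedness at the final time from a representative continuous up to `T`.** If `u`
is continuous on `(0, T) × ℝ³` and agrees a.e. there with a field `w` continuous on
`(0, T] × ℝ³`, then `u` is bounded on `(T - r², T) × B(x₀, r)`, `r = min 1 √(T/2)`, for every
`x₀`: `w` is bounded on the compact `[T/2, T] × B̄(x₀, 1)`, the a.e. equality transfers the bound to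
`u` a.e. on the open `(T/2, T) × B(x₀, 1)`, and an a.e. inequality between continuous functions on
an open set holds at every point (`SereginSverak2009.forall_le_of_ae_le_of_continuousOn`).
[folklore] -/
theorem isBoundedNearTop_of_ae_eq_continuousOn_Ioc (hT : 0 < T)
    (hu : ContinuousOn (uncurry u) (Ioo 0 T ×ˢ univ))
    {w : ℝ → EuclideanSpace ℝ (Fin 3) → EuclideanSpace ℝ (Fin 3)}
    (hw : ContinuousOn (uncurry w) (Ioc 0 T ×ˢ univ))
    (hae : uncurry u =ᵐ[volume.restrict (Ioo 0 T ×ˢ univ)] uncurry w)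
    (x₀ : EuclideanSpace ℝ (Fin 3)) : IsBoundedNearTop u T x₀ := by
  -- a bound for `w` on the compact `[T/2, T] × closedBall x₀ 1 ⊆ (0, T] × ℝ³`
  set K : Set (ℝ × EuclideanSpace ℝ (Fin 3)) := Icc (T / 2) T ×ˢ closedBall x₀ 1 with hK
  have hKc : IsCompact K := isCompact_Icc.prod (isCompact_closedBall _ _)
  have hKsub : K ⊆ Ioc 0 T ×ˢ univ :=
    prod_mono (fun t ht => ⟨by linarith [ht.1], ht.2⟩) (subset_univ _)
  obtain ⟨M, hM⟩ := hKc.exists_bound_of_continuousOn (hw.mono hKsub)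
  -- the open set `(T/2, T) × ball x₀ 1`, inside `K` and inside the open slab
  set U : Set (ℝ × EuclideanSpace ℝ (Fin 3)) := Ioo (T / 2) T ×ˢ ball x₀ 1 with hU
  have hUopen : IsOpen U := isOpen_Ioo.prod isOpen_ball
  have hUK : U ⊆ K := prod_mono Ioo_subset_Icc_self ball_subset_closedBall
  have hUslab : U ⊆ Ioo 0 T ×ˢ univ :=
    prod_mono (fun t ht => ⟨by linarith [ht.1], ht.2⟩) (subset_univ _)
  -- the bound holds for `u` a.e. on `U`, hence everywhere on `U` by continuity
  have haeU : ∀ᵐ z ∂(volume.restrict U), ‖uncurry u z‖ ≤ M := by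
    filter_upwards [ae_restrict_of_ae_restrict_of_subset hUslab hae,
      ae_restrict_mem hUopen.measurableSet] with z hz hzU
    rw [hz]
    exact hM z (hUK hzU)
  have hall := SereginSverak2009.forall_le_of_ae_le_of_continuousOn hUopen (hu.mono hUslab).norm
    continuousOn_const haeU
  -- the backward parabolic neighbourhood of radius `r = min 1 √(T/2)` lies in `U`
  set r : ℝ := min 1 (Real.sqrt (T / 2)) with hr
  have hr0 : 0 < r := lt_min one_pos (Real.sqrt_pos.2 (half_pos hT))
  have hr1 : r ≤ 1 := min_le_left _ _
  have hr2 : r ^ 2 ≤ T / 2 := by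
    have h1 : r ≤ Real.sqrt (T / 2) := min_le_right _ _
    have h2 : r ^ 2 ≤ Real.sqrt (T / 2) ^ 2 := pow_le_pow_left₀ hr0.le h1 2
    rwa [Real.sq_sqrt (half_pos hT).le] at h2
  exact ⟨r, hr0, M, fun t ht x hx =>
    hall (t, x) ⟨⟨by linarith [ht.1], ht.2⟩, ball_subset_ball hr1 hx⟩⟩

/-- **Lei–Zhang 2011, Thm. 1.4, for a unit-viscosity witness with a `BMO` stream function.** A
classical Leray–Hopf solution `(u, p)` on `[0, T)` (`ν = 1`) from a rapidly decaying axisymmetric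
datum whose velocity admits a stream function with `BMO` slices bounded uniformly on `(0, T)` has a
representative smooth on `(0, T] × ℝ³`: the hypotheses of the tree form
`LeiZhang2011_regularity_bmoStream` (proved: `LeiZhang2011_regularity_bmoStream_holds`) are
supplied by the standing hypotheses `AxisymmetricL3Hyp 1 T u p` of the class (suitability on the
open slab `(0, T) × ℝ³` with the original pressure, axisymmetric slices) and by the bounded initial
swirl of a rapidly decaying datum.
[cite: LeiZhang2011, Thm. 1.4 (arXiv:1011.5066 p. 4; §4 pp. 12–13)] -/
theorem exists_smooth_representative_of_hasBMOStreamFunctionOn_one (hT : 0 < T)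
    (hcl : IsClassicalNSSolutionOn (Ico 0 T) 1 0 u p) (hLH : IsLerayHopfOn T 1 0 (u 0) u)
    (hdec : HasRapidSpatialDecay (u 0)) (haxi : IsAxisymmetric (u 0))
    (hB : ∃ (B : ℝ → EuclideanSpace ℝ (Fin 3) → EuclideanSpace ℝ (Fin 3)) (C : ℝ≥0),
      HasBMOStreamFunctionOn (Ioo 0 T) u B C) :
    ∃ w : ℝ → EuclideanSpace ℝ (Fin 3) → EuclideanSpace ℝ (Fin 3),
      ContDiffOn ℝ ((⊤ : ℕ∞) : WithTop ℕ∞) (uncurry w) (Ioc 0 T ×ˢ univ) ∧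
        uncurry u =ᵐ[volume.restrict (Ioo 0 T ×ˢ univ)] uncurry w := by
  have H : AxisymmetricL3Hyp 1 T u p :=
    axisymmetricL3Hyp_of_lerayHopf_classical one_pos hT hcl hLH hdec haxi
  have hsuit : IsSuitableWeakSolutionOn
      (slab (EuclideanSpace ℝ (Fin 3)) (Ioo 0 T) isOpen_Ioo) 1 0 u p :=
    H.isSuitableWeakSolutionOn _ (by simp)
  exact LeiZhang2011_regularity_bmoStream_holds T hT u p hsuit hLH
    (fun t ht => H.axisymmetric t (Ioo_subset_Ico_self ht)) hdec.abs_swirl_le hB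

end Witness

/-- **No unit-viscosity witness of the crux admits a stream function bounded in `BMO` up to the
singular time** (registered stub of stmt-NavierStokesRegularity-0727; Lei–Zhang 2011, Thm. 1.4 at
the crux `CertifiedBlowupAxisymBlowup`): for a maximal Leray–Hopf classical solution `(u, p)` of
unit viscosity and finite lifespan `T` from a rapidly decaying axisymmetric datum there are no
`B : ℝ → ℝ³ → ℝ³` and `C` with `B(t)` differentiable, `∇ × B(t) = u(t)` a.e. and `‖B(t)‖_BMO ≤ C`
for all `t ∈ (0, T)` — i.e. `u ∉ L^∞(0, T; BMO⁻¹)` in stream-function form, Koch–Tataru's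
question at the blow-up. Otherwise `u` has a smooth representative on `(0, T] × ℝ³`
(`exists_smooth_representative_of_hasBMOStreamFunctionOn_one`), so EVERY point is a point of local
boundedness at `T` (`isBoundedNearTop_of_ae_eq_continuousOn_Ioc`), contradicting the nonempty
blow-up set of a witness (`exists_not_isBoundedNearTop_of_isMaximalSmoothSolution`). Unit
viscosity is no restriction by the landed normal form `certifiedBlowupAxisymBlowup_iff_forall_nu_T`;
the statement strictly generalises the landed no-axis-bound `not_axisBound_of_isMaximalSmoothSolution`.
[cite: LeiZhang2011, Thm. 1.4 (arXiv:1011.5066 p. 4; §4 pp. 12–13)] -/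
theorem not_hasBMOStreamFunction_of_isMaximalSmoothSolution_one : ∀ {T : ℝ} {u : ℝ → EuclideanSpace ℝ (Fin 3) → EuclideanSpace ℝ (Fin 3)} {p : ℝ → EuclideanSpace ℝ (Fin 3) → ℝ}, 0 < T → IsMaximalSmoothSolution 1 0 u p T → IsLerayHopfOn T 1 0 (u 0) u → HasRapidSpatialDecay (u 0) → IsAxisymmetric (u 0) → ¬ ∃ (B : ℝ → EuclideanSpace ℝ (Fin 3) → EuclideanSpace ℝ (Fin 3)) (C : NNReal), HasBMOStreamFunctionOn (Set.Ioo 0 T) u B C := by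
  intro T u p hT hmax hLH hdec haxi hB
  obtain ⟨w, hw, hae⟩ :=
    exists_smooth_representative_of_hasBMOStreamFunctionOn_one hT hmax.1 hLH hdec haxi hB
  obtain ⟨x₀, hx₀⟩ :=
    exists_not_isBoundedNearTop_of_isMaximalSmoothSolution one_pos hT hmax hLH hdec haxi
  have hu : ContinuousOn (uncurry u) (Ioo 0 T ×ˢ univ) :=
    (hmax.1.mono Ioo_subset_Ico_self isOpen_Ioo.uniqueDiffOn).smooth_velocity.continuousOn
  exact hx₀ (isBoundedNearTop_of_ae_eq_continuousOn_Ioc hT hu hw.continuousOn hae x₀)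

end Summit.NavierStokesRegularity.NavierStokesRegularity.Theorems.CertifiedBlowupAxisymBlowup.CompactAmplification

end
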